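import Summits.MatrixMultiplication.OmegaCensus.ThreeSetZ5Z5Cells44
import Summits.MatrixMultiplication.OmegaCensus.DominoZpZpScaled
import Summits.MatrixMultiplication.OmegaCensus.DominoZpZpConsistAlg
import Summits.MatrixMultiplication.OmegaCensus.ThreeSetLineInverseCertificate
import HarnessLib

/-!
# Three-set cube cells `(4, d, e)@p²` over `A ↠ ℤ_p²` (`|A| = p²`): reduction of a cube symmetric form to a KILLER line datum — generic `p`

ω-census `pub-omega`, family (b3), seat pub-omega-group gen 39.  Framing: lottery ticket; floor = certified bounds/negative ranges.
VALUE: the structural half of the W-level kernel route for three-set cells with a part of size `4` over `ℤ_p²` (`(4,4,6)@289` done in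
`ThreeSetZ17Frame446`; next `(4,5,6)@361`, `(4,4,11)@529`, `(4,4,20)@961`, …), stated once for every prime `p`: the per-cell inputs are a
W-COVER hypothesis (`hcov`, a decided table per `p`: every frame `{0, e₁, e₂, c}` has a non-zero line form `u ↦ a u₁ + b u₂`, a shift `β` and
a killer index `k` with the frame's shifted line datum equal to killer `k`) and, downstream, the killer computations; NOT progress on ω.

**Theorem (`exists_killer_line_of_cube_form_4_sq`).**  `p` prime, `|A| = p²`, `Φ : A ↠ ℤ_p²`, `(W, X, Y, x₀)` a cube symmetric form with
`|W| = 4`, `|X| = d`, `|Y| = e`, and a cover `hcov` for the killer list `KILS` (`nk` entries): then some killer `κ_k` carries a solution of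
the three-set line identity `Σ_u M_{κ,F}(τ,u) G(u) + [s = τ] = p` with `F ∈ compsLit p d`, `G ≤ e`.  Proof as in `ThreeSetZ17Frame446`
(translate, frame by a non-degenerate pair or `card_eq_one_of_subset_coset`, `basisEquiv`, injectivity of `Φ'` from `|A| = p²`, the cover,
translation by `t ∈ φ⁻¹(β)`, `three_set_line_identity` with fibre `|A|/p = p`).
-/

namespace Summit.MatrixMultiplication.OmegaCensus

open Finset ZpZpDomino

namespace ZpFrame4

/-! ## Small facts about `ℤ₁₇` and `ℤ₁₇²` -/

variable {p : ℕ} [Fact p.Prime]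

/-- Three pairwise dependent vectors of `ℤ_p²` are killed by a common non-zero linear form. [folklore] -/
theorem exists_form_of_dets_eq_zero (u v w : ZMod p × ZMod p)
    (huv : u.1 * v.2 - u.2 * v.1 = 0) (huw : u.1 * w.2 - u.2 * w.1 = 0) (hvw : v.1 * w.2 - v.2 * w.1 = 0) :
    ∃ ab : ZMod p × ZMod p, ab ≠ 0 ∧ ab.1 * u.1 + ab.2 * u.2 = 0 ∧ ab.1 * v.1 + ab.2 * v.2 = 0 ∧ ab.1 * w.1 + ab.2 * w.2 = 0 := by
  by_cases hu : u = 0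
  · by_cases hv : v = 0
    · by_cases hw : w = 0
      · exact ⟨(1, 0), by simp, by simp [hu], by simp [hv], by simp [hw]⟩
      · refine ⟨(w.2, -w.1), ?_, by simp [hu], by simp [hv], by ring⟩
        intro h
        apply hw
        have h1 : w.2 = 0 := by simpa using congrArg Prod.fst h
        have h2 : w.1 = 0 := by simpa using congrArg Prod.snd h
        exact Prod.ext h2 h1
    · refine ⟨(v.2, -v.1), ?_, by simp [hu], by ring, by linear_combination (-1 : ZMod p) * hvw⟩
      intro h
      apply hv
      have h1 : v.2 = 0 := by simpa using congrArg Prod.fst h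
      have h2 : v.1 = 0 := by simpa using congrArg Prod.snd h
      exact Prod.ext h2 h1
  · refine ⟨(u.2, -u.1), ?_, by ring, by linear_combination (-1 : ZMod p) * huv, by linear_combination (-1 : ZMod p) * huw⟩
    intro h
    apply hu
    have h1 : u.2 = 0 := by simpa using congrArg Prod.fst h
    have h2 : u.1 = 0 := by simpa using congrArg Prod.snd h
    exact Prod.ext h2 h1

/-- A natural number cast to `ℤ_p` equals `v` iff its residue is `v.val`. [folklore] -/
theorem natCast_eq_iff_mod (n : ℕ) (v : ZMod p) : ((n : ZMod p) = v) ↔ n % p = v.val := by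
  constructor
  · intro h; rw [← h, ZMod.val_natCast]
  · intro h; apply ZMod.val_injective p; rw [ZMod.val_natCast, h]


section Core

variable {A : Type*} [AddCommGroup A] [Fintype A] [DecidableEq A]

/-- All fibres of a surjection onto `ZMod p` have size `|A| / p`: `p · |φ⁻¹(0)| = |A|`. [folklore] -/
theorem p_mul_card_fibre (φ : A →+ ZMod p) (hφ : Function.Surjective φ) :
    p * (univ.filter fun a : A => φ a = 0).card = Fintype.card A := by
  classical
  rw [← Finset.card_univ (α := A), Finset.card_eq_sum_card_fiberwise (f := fun a : A => φ a) (s := univ) (t := univ)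
    (fun a _ => mem_coe.2 (mem_univ _))]
  rw [Finset.sum_congr rfl fun t _ => card_fibre_eq_of_surjective φ hφ t 0, sum_const, card_univ, ZMod.card, smul_eq_mul]

omit [Fintype A] [DecidableEq A] in
/-- The fibre counts of a finset along `φ : A → ℤ_p` sum to its size. [folklore] -/
theorem sum_card_filter_eq (φ : A →+ ZMod p) (X : Finset A) :
    ∑ v : ZMod p, (X.filter fun x => φ x = v).card = X.card := by
  classical
  rw [Finset.card_eq_sum_card_fiberwise (f := fun a : A => φ a) (s := X) (t := univ) (fun a _ => mem_coe.2 (mem_univ _))]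

/-- **Core step** (frame ordered, generic `p`): translated symmetric form `(W', X', Y', x₀')` with `W' = {0, a, b, c}` (distinct,
non-zero), `det(Φ a, Φ b) ≠ 0`, `|X'| = d`, `|Y'| = e`, `|A| = p²`, and a W-cover `hcov` for the killer list `KILS` ⇒ a killer line datum
carries a solution of the line identity with `K = p`. [folklore] -/
theorem exists_killer_line_core (hp5 : 5 ≤ p) {d e nk : ℕ} (KILS : List (List ℕ))
    (hcov : ∀ ci, ci < p * p → ¬(ci = 0 ∨ ci = 1 ∨ ci = p) →
      ∃ a b β k : ℕ, (a ≠ 0 ∨ b ≠ 0) ∧ a < p ∧ b < p ∧ β < p ∧ k < nk ∧ ∀ v, v < p →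
        ((if β % p = v then 1 else 0) + (if (a + β) % p = v then 1 else 0) + (if (b + β) % p = v then 1 else 0) +
          (if (a * (ci / p) + b * (ci % p) + β) % p = v then 1 else 0)) = (KILS.getD k []).getD v 0)
    (hA : Fintype.card A = p * p) (Φ : A →+ ZMod p × ZMod p) (hΦ : Function.Surjective Φ)
    {W' X' Y' : Finset A} {x₀' a b c : A} (hWt : W' = {0, a, b, c}) (ha0 : a ≠ 0) (hb0 : b ≠ 0) (hc0 : c ≠ 0)
    (hab : a ≠ b) (hac : a ≠ c) (hbc : b ≠ c) (hD : (Φ a).1 * (Φ b).2 - (Φ a).2 * (Φ b).1 ≠ 0) (hX : X'.card = d)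
    (hY : Y'.card = e)
    (t₁ : Set.InjOn (fun p : A × A × A => -p.1 + p.2.1 + p.2.2) ↑(W' ×ˢ X' ×ˢ Y'))
    (t₂ : Set.InjOn (fun p : A × A × A => p.1 - p.2.1 + p.2.2) ↑(W' ×ˢ X' ×ˢ Y'))
    (t₃ : Set.InjOn (fun p : A × A × A => p.1 + p.2.1 - p.2.2) ↑(W' ×ˢ X' ×ˢ Y'))
    (e₁₂ : Disjoint ((W' ×ˢ X' ×ˢ Y').image fun p : A × A × A => -p.1 + p.2.1 + p.2.2)
      ((W' ×ˢ X' ×ˢ Y').image fun p : A × A × A => p.1 - p.2.1 + p.2.2))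
    (e₁₃ : Disjoint ((W' ×ˢ X' ×ˢ Y').image fun p : A × A × A => -p.1 + p.2.1 + p.2.2)
      ((W' ×ˢ X' ×ˢ Y').image fun p : A × A × A => p.1 + p.2.1 - p.2.2))
    (e₂₃ : Disjoint ((W' ×ˢ X' ×ˢ Y').image fun p : A × A × A => p.1 - p.2.1 + p.2.2)
      ((W' ×ˢ X' ×ˢ Y').image fun p : A × A × A => p.1 + p.2.1 - p.2.2))
    (tcov : ((W' ×ˢ X' ×ˢ Y').image fun p : A × A × A => -p.1 + p.2.1 + p.2.2) ∪
      ((W' ×ˢ X' ×ˢ Y').image fun p : A × A × A => p.1 - p.2.1 + p.2.2) ∪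
      ((W' ×ˢ X' ×ˢ Y').image fun p : A × A × A => p.1 + p.2.1 - p.2.2) = univ.erase x₀') :
    ∃ k, k < nk ∧ ∃ Fl : List ℕ, Fl ∈ ZpZpDomino.compsLit p d ∧ ∃ (G : ZMod p → ℕ) (s : ZMod p), (∀ u, G u ≤ e) ∧
      ∀ τ : ZMod p, (∑ u : ZMod p, lineMat3 (vecFn (KILS.getD k [])) (vecFn Fl) τ u * G u) +
        (if s = τ then 1 else 0) = p := by
  classical
  have hp0 : 0 < p := by omega
  haveI : NeZero p := ⟨hp0.ne'⟩
  set E := basisEquiv (Φ a) (Φ b) hD with hE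
  set Φ' : A →+ ZMod p × ZMod p := E.symm.toAddMonoidHom.comp Φ with hΦ'
  have hΦ's : Function.Surjective Φ' := E.symm.surjective.comp hΦ
  have hΦ'a : Φ' a = (1, 0) := by
    show E.symm (Φ a) = _
    rw [AddEquiv.symm_apply_eq]; exact (basisEquiv_one_zero _ _ hD).symm
  have hΦ'b : Φ' b = (0, 1) := by
    show E.symm (Φ b) = _
    rw [AddEquiv.symm_apply_eq]; exact (basisEquiv_zero_one _ _ hD).symm
  have hinj : Function.Injective Φ' :=
    ((Fintype.bijective_iff_surjective_and_card Φ').2 ⟨hΦ's, by rw [hA, Fintype.card_prod, ZMod.card]⟩).1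
  -- the fourth point
  set ci : ℕ := ptIdx p (Φ' c) with hcidef
  have hci : ci < p * p := ptIdx_lt p _
  have hc' : Φ' c = pt p ci := by rw [hcidef, pt_ptIdx]
  have hnot : ¬(ci = 0 ∨ ci = 1 ∨ ci = p) := by
    rintro (h | h | h)
    · apply hc0; apply hinj; rw [hc', h, map_zero]
      ext <;> simp [pt]
    · apply hbc.symm; apply hinj; rw [hc', h, hΦ'b]
      have h1p : 1 / p = 0 := Nat.div_eq_of_lt (by omega)
      have h1m : 1 % p = 1 := Nat.mod_eq_of_lt (by omega)
      ext <;> simp [pt, h1p, h1m]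
    · apply hac.symm; apply hinj; rw [hc', h, hΦ'a]
      ext <;> simp [pt, Nat.div_self hp0, Nat.mod_self]
  obtain ⟨α, β, sh, k, hne, hα, hβ, hsh, hk, hcnt⟩ := hcov ci hci hnot
  -- the killing line form and the re-translation
  set ψ : ZMod p × ZMod p →+ ZMod p := lmap (α : ZMod p) (β : ZMod p) with hψ
  have hψne : (α : ZMod p) ≠ 0 ∨ (β : ZMod p) ≠ 0 := by
    rcases hne with h | h
    · left; intro e; apply h
      have := (natCast_eq_iff_mod α 0).1 e
      rw [ZMod.val_zero, Nat.mod_eq_of_lt hα] at this; exact this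
    · right; intro e; apply h
      have := (natCast_eq_iff_mod β 0).1 e
      rw [ZMod.val_zero, Nat.mod_eq_of_lt hβ] at this; exact this
  set φ : A →+ ZMod p := ψ.comp Φ' with hφ
  have hφs : Function.Surjective φ := (lmap_surjective_of_ne hψne).comp hΦ's
  have eφ : ∀ x, φ x = ψ (Φ' x) := fun x => rfl
  obtain ⟨t, ht⟩ := hφs (sh : ZMod p)
  obtain ⟨u₁, u₂, u₃, f₁₂, f₁₃, f₂₃, ucov, cW, cX, cY⟩ := cube_symmetric_form_translate t₁ t₂ t₃ e₁₂ e₁₃ e₂₃ tcov t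
  set W'' := W'.image (· + t) with hW''
  set X'' := X'.image (· + t) with hX''
  set Y'' := Y'.image (· + t) with hY''
  have hWtt : W'' = {t, a + t, b + t, c + t} := by
    rw [hW'', hWt, image_insert, image_insert, image_insert, image_singleton, zero_add]
  -- the W-line datum is the killer `k`
  have hφt : φ t = ((sh : ℕ) : ZMod p) := ht
  have hφa : φ (a + t) = ((α + sh : ℕ) : ZMod p) := by
    rw [map_add, ht, eφ, hΦ'a, hψ, lmap_apply]; push_cast; ring
  have hφb : φ (b + t) = ((β + sh : ℕ) : ZMod p) := by
    rw [map_add, ht, eφ, hΦ'b, hψ, lmap_apply]; push_cast; ring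
  have hφc : φ (c + t) = ((α * (ci / p) + β * (ci % p) + sh : ℕ) : ZMod p) := by
    rw [map_add, ht, eφ, hc', hψ, lmap_apply, pt]; push_cast; ring
  have nt : t ∉ ({a + t, b + t, c + t} : Finset A) := by
    simp only [mem_insert, mem_singleton, not_or]
    refine ⟨fun h => ha0 ?_, fun h => hb0 ?_, fun h => hc0 ?_⟩
    · exact (add_right_cancel ((zero_add t).trans h)).symm
    · exact (add_right_cancel ((zero_add t).trans h)).symm
    · exact (add_right_cancel ((zero_add t).trans h)).symm
  have na : a + t ∉ ({b + t, c + t} : Finset A) := by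
    simp only [mem_insert, mem_singleton, not_or]
    exact ⟨fun h => hab (add_right_cancel h), fun h => hac (add_right_cancel h)⟩
  have nb : b + t ∉ ({c + t} : Finset A) := by
    simp only [mem_singleton]
    exact fun h => hbc (add_right_cancel h)
  have hWc : ∀ v : ZMod p, (W''.filter fun x => φ x = v).card =
      vecFn (KILS.getD k []) v := by
    intro v
    have hv := ZMod.val_lt v
    unfold vecFn
    rw [← hcnt v.val hv, hWtt, card_filter, sum_insert nt, sum_insert na, sum_insert nb, sum_singleton, hφt, hφa, hφb, hφc]
    simp only [natCast_eq_iff_mod]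
    ring
  -- the X-line datum as a list of mass 4
  set Fl : List ℕ := (List.range p).map (fun n : ℕ => (X''.filter fun x => φ x = ((n : ℕ) : ZMod p)).card) with hFl
  have hXc : ∀ w : ZMod p, (X''.filter fun x => φ x = w).card = vecFn Fl w := by
    intro w
    unfold vecFn
    rw [hFl, ZpZpDomino.getD_map_range _ (ZMod.val_lt w), ZMod.natCast_zmod_val]
  have hFlmem : Fl ∈ compsLit p d := by
    refine mem_compsLit p d Fl (by rw [hFl, List.length_map, List.length_range]) ?_
    rw [hFl, LineInv.sum_range_map, ← LineInv.sum_zmod_val (q := p)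
      (fun n : ℕ => (X''.filter fun x => φ x = ((n : ℕ) : ZMod p)).card)]
    simp only [ZMod.natCast_zmod_val]
    rw [sum_card_filter_eq φ X'', cX, hX]
  -- the Y-line datum and the fibre size
  have hGle : ∀ u : ZMod p, (Y''.filter fun x => φ x = u).card ≤ e := fun u =>
    (card_filter_le _ _).trans (by rw [cY, hY])
  have hK : (univ.filter fun x : A => φ x = 0).card = p := by
    have h17 := p_mul_card_fibre φ hφs
    rw [hA] at h17
    exact Nat.eq_of_mul_eq_mul_left hp0 h17
  have hid : ∀ τ : ZMod p, (∑ u : ZMod p, lineMat3 (vecFn (KILS.getD k []))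
      (vecFn Fl) τ u * (Y''.filter fun x => φ x = u).card) + (if φ (x₀' + t) = τ then 1 else 0) = p := by
    refine lineMat3_identity_of_double_sum fun τ => ?_
    have h0 := ThreeSetNorm.three_set_line_identity φ hφs u₁ u₂ u₃ f₁₂ f₁₃ f₂₃ ucov τ
    simp only [hWc, hXc, hK] at h0
    exact h0
  exact ⟨k, hk, Fl, hFlmem, _, φ (x₀' + t), hGle, hid⟩

end Core

end ZpFrame4

end Summit.MatrixMultiplication.OmegaCensus
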